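import Summits.Ventures.CertifiedManyBodySolver.Observables.StiffnessThermalOddMomentCeiling
import HarnessLib

/-!
# The thermal ODD-MOMENT (Krylov-3) hook: one certified thermal linear word `F_λ(ω_β) ≤ q` at one `β`
# feeds the single-temperature Kosterlitz–Thouless closure (part 2 of 2 of «ROUTE T-B′», cell `pub/hubbard-tc`)

HONEST FRAMING: ladder R1–R4 with certified numbers; no claim on H/H₀. Cell `pub/hubbard-tc` (MO-S3 ORDER → T_c
back-end), seat `hubbard-tc-mod-2` (KT back-end; HOME/hubbard-tc-mod-2/KT-THERMAL-INTERFACE.md §3c). A one-sided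
CEILING chain (thermal Gibbs words ⇒ flux stiffness ⇒ `T_KT`); not a superconductivity verdict, not a `T_c` of any
material; NO certificate and NO number lives in this file.

The f-sum thermal hook (ROUTE T-A, `StiffnessThermalTorusLimitKinetic`) reads the leaf `ObsThermalStiffnessSeqCeilingAtBeta`
off ONE certified thermal word `Re ω_β(k₀)`; that class saturates at `T* ≈ 0.20·t` because `⟨−k_x⟩_β` does not vanish.
Part 1 (`StiffnessThermalOddMomentCeiling.lean`) proved the THERMAL fixed-`λ` odd-moment ceiling and the locality of its
words. Here:

* §1 `thermalStiffness_le_re_sectorGibbsAvg_oddMomentObs` — finite volume in hubbard-thermal's mixture vocabulary: at every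
  side `L ≥ 15`, `ρ_s ≤ Re Σ_i p_{L,i}(β)·torusAvg_{[-7,7]²}(½Γk₀ + λΓd₁ − (λ²/2)m₃′)(ψ_{L,i})` for the eigen-mixture of the
  canonical `(rectN n L, S^z = 0)` Gibbs state of `hubbardTorusTT' L 1 t′ U` at `β` and every real `λ`.
* §2 `ObsThermalStiffnessSeqCeilingAtBeta_of_torusLimit_oddMoment_le` — **the hook**: if every torus limit `ω` of those
  Gibbs states satisfies `oddMomentLimitFunctionalTT t′ U λ ω = ½Re ω(k₀) + λRe ω(d₁) − (λ²/2)Re ω(m₃′) ≤ q` (ONE certified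
  thermal LINEAR word cap at a fixed rational `λ` — the SAME objective words hubbard-obs certifies at `T = 0`, menu edge
  `stiffK3`), then `ObsThermalStiffnessSeqCeilingAtBeta t′ U n β q` (compactness + `limsup`,
  `eventually_re_sectorGibbsAvg_le_of_forall_torusLimit`). At `λ = 0` this is ROUTE T-A verbatim.
* §3 closures `ThermalKTDictionaryAt.le_inv_of_torusLimit_oddMoment_le` (`(π/4)q < 1/β ⇒ Tc ≤ 1/β`; keys K1t K1b K2,
  NO monotonicity) and the row form `le_quarter_of_torusLimit_oddMoment_le_four` at `(8, ⅞, 0)`, `β·t = 4`: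
  `q < 0.3183098 ⇒ Tc ≤ 1/4` — the monotonicity-free door for «`T_KT ≤ t/4`» below the f-sum class (today's certified
  kinetic leaf alone reads `0.3979`, p489810: a certified odd-moment gain `≥ 0.0797` per site at `β·t = 4` closes it).

WHAT THIS IS NOT: no thermal certificate of the word exists today (the thermal relaxation's pinning of `d₁`, `m₃′` decides
when a row exists); the class reaches the regular (finite-frequency) optical weight, never the Drude-type part.

References: DLS1978 §2 eqs. (22′), (27), (28); Lipparini2008 eq. (8.30); ScalapinoWhiteZhang1993 §II;
ParamekantiTrivediRanderia1998 §IV; HazraVermaRanderia2019 eqs. (2)–(4); Israel1979 §I.3 eq. (26); BratteliRobinsonI1987 §4.3.1.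
-/

noncomputable section

namespace Summit.Ventures.CertifiedManyBodySolver.Observables

open Filter Topology Matrix Finset
open Literature.MathematicalPhysics.QuantumLattice
open Literature.MathematicalPhysics.QuantumLattice.ThermodynamicLimit
open Literature.MathematicalPhysics.QuantumFieldTheory
open Literature.MathematicalPhysics.StatisticalMechanics
open Literature.MathematicalPhysics.StatisticalMechanics.KosterlitzThouless
open Literature.Probability.LatticeModels
open scoped ComplexConjugate ComplexOrder

/-! ## §1 Finite volume in the mixture vocabulary -/

section Mixture

variable {L : ℕ} [NeZero L]

/-- **Finite volume, in hubbard-thermal's mixture vocabulary**: at every side `L ≥ 15` the thermal odd-moment ceiling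
reads, for every real `λ` and every `ρ_s` admissible for the flux-twisted canonical-sector log-partition function at `β`,
`ρ_s ≤ Re Σ_i p_{L,i}(β) · torusAvg_{[-7,7]²}(½Γk₀ + λΓd₁ − (λ²/2)m₃′)(ψ_{L,i})`, `(p_{L,i}, ψ_{L,i})` the eigen-mixture of the
canonical `(rectN n L, S^z = 0)` Gibbs state of `hubbardTorusTT' L 1 t′ U` (`sectorGibbsWeightTT'`, `sectorGibbsVectorTT'`).
[cite: DLS1978, §2 eqs. (22'), (27), (28)] [cite: Lipparini2008, eq. (8.30)] -/
theorem thermalStiffness_le_re_sectorGibbsAvg_oddMomentObs {tp U n β : ℝ} (hβ : 0 < β) (hL : 15 ≤ L)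
    {ρs θ₀ : ℝ} (hθ₀ : 0 < θ₀)
    (hst : ∀ θ : ℝ, |θ| ≤ θ₀ →
      β * ρs * θ ^ 2 ≤ thermalFluxLogZ L tp U (1 - n) β 0 - thermalFluxLogZ L tp U (1 - n) β θ) (lam : ℝ) :
    ρs ≤ (∑ i, (sectorGibbsWeightTT' β 1 tp U n L i : ℂ) *
        torusAvgExpect L (box 2 7) (((1 / 2 : ℝ) : ℂ) • fermionEmbed (PolySite.incl (box_subset_box (by norm_num) : box 2 1 ⊆ box 2 7))
          (kinBondObsTT tp) + ((lam : ℝ) : ℂ) • fermionEmbed (PolySite.incl (box_subset_box (by norm_num) : box 2 4 ⊆ box 2 7))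
          (firstMomentObsTT tp U) - ((lam ^ 2 / 2 : ℝ) : ℂ) • thirdMomentObsTT tp U) (sectorGibbsVectorTT' 1 tp U n L i)).re := by
  -- notation
  set p : Finset (Orb (FermionTorus 2 L)) → Prop := fun s =>
    s.card = 2 * ⌊(1 - (1 - n)) * (L : ℝ) ^ 2 / 2⌋₊ ∧
      2 * (s.filter fun i => (ofLex i).2 = 0).card = 2 * ⌊(1 - (1 - n)) * (L : ℝ) ^ 2 / 2⌋₊ with hpdef
  set H := hubbardTorusTT' L 1 tp U with hHdef
  set J := curOpTT' L tp with hJdef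
  set K := kinOpTT' L tp with hKdef
  have hL0 : (0 : ℝ) < (L : ℝ) := by exact_mod_cast (show 0 < L by omega)
  have hL2 : (0 : ℝ) < (L : ℝ) ^ 2 := by positivity
  -- §1 at side `L` in the block vocabulary
  have hfin := thermalStiffnessTT'_mul_sq_le_kinetic_add_oddMoments (L := L) (by omega) tp U hβ hθ₀ p
    (by intro θ hθ; simpa only [thermalFluxLogZ] using hst θ hθ) lam
  obtain ⟨hle, -, -⟩ := hfin
  -- blocks of products are products of blocks (all operators conserve `N↑`, `N↓`)
  have hp : ∀ s, p s ↔ (upPart s).card = halfRectN n L ∧ (downPart s).card = halfRectN n L :=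
    sectorPred_iff_upPart_downPart n L
  have hPH : PreservesSectors H := preservesSectors_hubbardTorusTT' 1 tp U
  have hPJ : PreservesSectors J := preservesSectors_curOpTT' (L := L) tp
  have hPB : PreservesSectors (H * J - J * H) := by
    rw [sub_eq_add_neg]; exact (hPH.mul hPJ).add ((hPJ.mul hPH).neg)
  have hB : (H * J - J * H).toBlock p p = H.toBlock p p * J.toBlock p p - J.toBlock p p * H.toBlock p p := by
    rw [toBlock_sub_self, toBlock_mul_of_toBlock_compl_eq_zero p H J (toBlock_compl_eq_zero_of_preservesSectors_torus hPH p hp),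
      toBlock_mul_of_toBlock_compl_eq_zero p J H (toBlock_compl_eq_zero_of_preservesSectors_torus hPJ p hp)]
  have hDJ : (J * (H * J - J * H) - (H * J - J * H) * J).toBlock p p =
      J.toBlock p p * (H.toBlock p p * J.toBlock p p - J.toBlock p p * H.toBlock p p) -
        (H.toBlock p p * J.toBlock p p - J.toBlock p p * H.toBlock p p) * J.toBlock p p :=
    toBlock_doubleComm_eq_of_preservesSectors hPH hPJ p hp
  have hDB : ((H * J - J * H) * (H * (H * J - J * H) - (H * J - J * H) * H) -
        (H * (H * J - J * H) - (H * J - J * H) * H) * (H * J - J * H)).toBlock p p =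
      (H.toBlock p p * J.toBlock p p - J.toBlock p p * H.toBlock p p) *
          (H.toBlock p p * (H.toBlock p p * J.toBlock p p - J.toBlock p p * H.toBlock p p) -
            (H.toBlock p p * J.toBlock p p - J.toBlock p p * H.toBlock p p) * H.toBlock p p) -
        (H.toBlock p p * (H.toBlock p p * J.toBlock p p - J.toBlock p p * H.toBlock p p) -
            (H.toBlock p p * J.toBlock p p - J.toBlock p p * H.toBlock p p) * H.toBlock p p) *
          (H.toBlock p p * J.toBlock p p - J.toBlock p p * H.toBlock p p) := by
    rw [toBlock_doubleComm_eq_of_preservesSectors hPH hPB p hp, hB]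
  rw [← hDJ, ← hDB] at hle
  -- block Gibbs expectations = mixture averages (hubbard-thermal's vocabulary)
  have hmix : ∀ X : Matrix (Finset (Orb (FermionTorus 2 L))) (Finset (Orb (FermionTorus 2 L))) ℂ,
      (gibbsState β (H.toBlock p p) (X.toBlock p p)).re =
        (∑ i, (sectorGibbsWeightTT' β 1 tp U n L i : ℂ) * expect X (sectorGibbsVectorTT' 1 tp U n L i)).re := by
    intro X
    rw [sum_sectorGibbsWeightTT'_mul_expect_eq_gibbsState, gibbsState_sectorHamiltonianTT'_eq_toBlock]
  rw [hmix K, hmix, hmix] at hle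
  -- the three expectations are `L²` × torus averages of the local words
  have h1 : Set.InjOn (Torus.proj (d := 2) L) ↑(box 2 1) := injOn_proj_box (by omega)
  have hK : ∀ ψ : Fock (Orb (FermionTorus 2 L)), expect K ψ = ((L : ℂ) ^ 2) * torusAvgExpectAt L (box 2 1) (kinBondObsTT tp) ψ := by
    intro ψ
    rw [hKdef, kinOpTT'_eq_sum_translate L tp h1, expect_sum_relabel_translate_fermionEmbed' L h1]
  simp_rw [hK, hHdef, hJdef, expect_cur_doubleComm_eq_sq_mul_torusAvg (L := L) tp U (by omega),
    expect_comm_doubleComm_eq_sq_mul_torusAvg tp U hL] at hle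
  simp_rw [torusAvgExpect_eq, torusAvgExpectAt_oddMomentWord_eq tp U lam hL]
  -- collect: everything is `L²` × (real part of a sum); divide by `L²`
  have hre : ∀ (f : Fin (sectorGibbsCount n L) → ℂ),
      (∑ i, (sectorGibbsWeightTT' β 1 tp U n L i : ℂ) * (((L : ℂ) ^ 2) * f i)).re =
        (L : ℝ) ^ 2 * (∑ i, (sectorGibbsWeightTT' β 1 tp U n L i : ℂ) * f i).re := by
    intro f
    rw [show (∑ i, (sectorGibbsWeightTT' β 1 tp U n L i : ℂ) * (((L : ℂ) ^ 2) * f i)) =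
        ((L : ℂ) ^ 2) * ∑ i, (sectorGibbsWeightTT' β 1 tp U n L i : ℂ) * f i by
      rw [Finset.mul_sum]; exact Finset.sum_congr rfl fun i _ => by ring,
      ← Complex.ofReal_natCast, ← Complex.ofReal_pow, Complex.re_ofReal_mul]
  rw [hre, hre, hre] at hle
  have hsplit : (∑ i, (sectorGibbsWeightTT' β 1 tp U n L i : ℂ) *
      (((1 / 2 : ℝ) : ℂ) * torusAvgExpectAt L (box 2 1) (kinBondObsTT tp) (sectorGibbsVectorTT' 1 tp U n L i) +
        ((lam : ℝ) : ℂ) * torusAvgExpectAt L (box 2 4) (firstMomentObsTT tp U) (sectorGibbsVectorTT' 1 tp U n L i) -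
        ((lam ^ 2 / 2 : ℝ) : ℂ) * torusAvgExpectAt L (box 2 7) (thirdMomentObsTT tp U) (sectorGibbsVectorTT' 1 tp U n L i))).re =
      (1 / 2) * (∑ i, (sectorGibbsWeightTT' β 1 tp U n L i : ℂ) *
          torusAvgExpectAt L (box 2 1) (kinBondObsTT tp) (sectorGibbsVectorTT' 1 tp U n L i)).re +
        lam * (∑ i, (sectorGibbsWeightTT' β 1 tp U n L i : ℂ) *
          torusAvgExpectAt L (box 2 4) (firstMomentObsTT tp U) (sectorGibbsVectorTT' 1 tp U n L i)).re -
        lam ^ 2 / 2 * (∑ i, (sectorGibbsWeightTT' β 1 tp U n L i : ℂ) *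
          torusAvgExpectAt L (box 2 7) (thirdMomentObsTT tp U) (sectorGibbsVectorTT' 1 tp U n L i)).re := by
    simp only [mul_add, mul_sub, Finset.sum_add_distrib, Finset.sum_sub_distrib, Complex.add_re, Complex.sub_re]
    rw [show (∑ i, (sectorGibbsWeightTT' β 1 tp U n L i : ℂ) * (((1 / 2 : ℝ) : ℂ) *
        torusAvgExpectAt L (box 2 1) (kinBondObsTT tp) (sectorGibbsVectorTT' 1 tp U n L i))) =
        ((1 / 2 : ℝ) : ℂ) * ∑ i, (sectorGibbsWeightTT' β 1 tp U n L i : ℂ) *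
          torusAvgExpectAt L (box 2 1) (kinBondObsTT tp) (sectorGibbsVectorTT' 1 tp U n L i) by
      rw [Finset.mul_sum]; exact Finset.sum_congr rfl fun i _ => by ring,
      show (∑ i, (sectorGibbsWeightTT' β 1 tp U n L i : ℂ) * (((lam : ℝ) : ℂ) *
        torusAvgExpectAt L (box 2 4) (firstMomentObsTT tp U) (sectorGibbsVectorTT' 1 tp U n L i))) =
        ((lam : ℝ) : ℂ) * ∑ i, (sectorGibbsWeightTT' β 1 tp U n L i : ℂ) *
          torusAvgExpectAt L (box 2 4) (firstMomentObsTT tp U) (sectorGibbsVectorTT' 1 tp U n L i) by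
      rw [Finset.mul_sum]; exact Finset.sum_congr rfl fun i _ => by ring,
      show (∑ i, (sectorGibbsWeightTT' β 1 tp U n L i : ℂ) * (((lam ^ 2 / 2 : ℝ) : ℂ) *
        torusAvgExpectAt L (box 2 7) (thirdMomentObsTT tp U) (sectorGibbsVectorTT' 1 tp U n L i))) =
        ((lam ^ 2 / 2 : ℝ) : ℂ) * ∑ i, (sectorGibbsWeightTT' β 1 tp U n L i : ℂ) *
          torusAvgExpectAt L (box 2 7) (thirdMomentObsTT tp U) (sectorGibbsVectorTT' 1 tp U n L i) by
      rw [Finset.mul_sum]; exact Finset.sum_congr rfl fun i _ => by ring,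
      Complex.re_ofReal_mul, Complex.re_ofReal_mul, Complex.re_ofReal_mul]
  rw [hsplit]
  -- `ρs L² ≤ L² · (…)` ⇒ `ρs ≤ …`
  have key : ρs * (L : ℝ) ^ 2 ≤ (L : ℝ) ^ 2 *
      ((1 / 2) * (∑ i, (sectorGibbsWeightTT' β 1 tp U n L i : ℂ) *
          torusAvgExpectAt L (box 2 1) (kinBondObsTT tp) (sectorGibbsVectorTT' 1 tp U n L i)).re +
        lam * (∑ i, (sectorGibbsWeightTT' β 1 tp U n L i : ℂ) *
          torusAvgExpectAt L (box 2 4) (firstMomentObsTT tp U) (sectorGibbsVectorTT' 1 tp U n L i)).re -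
        lam ^ 2 / 2 * (∑ i, (sectorGibbsWeightTT' β 1 tp U n L i : ℂ) *
          torusAvgExpectAt L (box 2 7) (thirdMomentObsTT tp U) (sectorGibbsVectorTT' 1 tp U n L i)).re) := by
    nlinarith [hle]
  exact le_of_mul_le_mul_right (by linarith [key]) hL2

end Mixture

/-! ## §2 The hook: a torus-limit bound on the fixed-`λ` word feeds the single-temperature leaf -/

section Hook

/-- **The single-temperature stiffness leaf from a torus-limit odd-moment bound (ROUTE T-B′).** If every torus
limit `ω` of the canonical `(rectN n L, S^z = 0)` Gibbs states of `hubbardTorusTT' L 1 t′ U` at inverse temperature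
`β` (`IsTorusLimitOfMixture` of `sectorGibbsWeightTT' β 1 t′ U n`, `sectorGibbsVectorTT' 1 t′ U n`; `0 ≤ n ≤ 2`) satisfies
`oddMomentLimitFunctionalTT t′ U λ ω = ½Re ω(k₀) + λ Re ω(d₁) − (λ²/2) Re ω(m₃′) ≤ q` for ONE fixed real `λ`, then
`ObsThermalStiffnessSeqCeilingAtBeta t′ U n β q`. Chain: the word as one local observable on `[-7,7]²`
(`expect_oddMomentWord_eq`) ⇒ compactness + `limsup` (`eventually_re_sectorGibbsAvg_le_of_forall_torusLimit`): for every
`ε > 0`, eventually in `L` the Gibbs-mixture torus average of the word is `≤ q + ε` ⇒ §2 at a large side of the given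
sequence ⇒ `ρ_s ≤ q + ε` ⇒ `ρ_s ≤ q`. At `λ = 0` this is ROUTE T-A. [cite: DLS1978, §2 eqs. (22'), (27), (28)]
[cite: Lipparini2008, eq. (8.30)] -/
theorem ObsThermalStiffnessSeqCeilingAtBeta_of_torusLimit_oddMoment_le {tp U n β : ℝ} (hβ : 0 < β)
    (hn0 : 0 ≤ n) (hn2 : n ≤ 2) (lam : ℝ) {q : ℚ}
    (hbound : ∀ (ω : InfVolFermionState 2) (Ls : ℕ → ℕ), Tendsto Ls atTop atTop →
      ω.IsTorusLimitOfMixture (sectorGibbsCount n) (fun L => sectorGibbsWeightTT' β 1 tp U n L)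
        (fun L => sectorGibbsVectorTT' 1 tp U n L) Ls →
      oddMomentLimitFunctionalTT tp U lam ω ≤ ((q : ℚ) : ℝ)) :
    ObsThermalStiffnessSeqCeilingAtBeta tp U n β q := by
  intro ρs θ₀ hρs hθ₀ Ls hLs hst
  refine le_of_forall_pos_le_add fun ε hε => ?_
  -- the word as ONE local observable, bounded on every torus limit
  have hbound' : ∀ (ω : InfVolFermionState 2) (Ls : ℕ → ℕ), Tendsto Ls atTop atTop →
      ω.IsTorusLimitOfMixture (sectorGibbsCount n) (fun L => sectorGibbsWeightTT' β 1 tp U n L)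
        (fun L => sectorGibbsVectorTT' 1 tp U n L) Ls →
      (ω.expect (box 2 7) (((1 / 2 : ℝ) : ℂ) • fermionEmbed (PolySite.incl (box_subset_box (by norm_num) : box 2 1 ⊆ box 2 7))
        (kinBondObsTT tp) + ((lam : ℝ) : ℂ) • fermionEmbed (PolySite.incl (box_subset_box (by norm_num) : box 2 4 ⊆ box 2 7))
        (firstMomentObsTT tp U) - ((lam ^ 2 / 2 : ℝ) : ℂ) • thirdMomentObsTT tp U)).re ≤ ((q : ℚ) : ℝ) := by
    intro ω Ls' hLs' hω
    rw [expect_oddMomentWord_eq]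
    exact hbound ω Ls' hLs' hω
  have hev := eventually_re_sectorGibbsAvg_le_of_forall_torusLimit 1 tp U hn0 hn2 β (box 2 7) _ hbound' hε
  -- along the sequence: eventually `Ls j ≥ 15` and the mixture bound holds at `Ls j`
  obtain ⟨j, hj15, hjb⟩ := ((hLs.eventually_ge_atTop 15).and (hLs.eventually hev)).exists
  haveI : NeZero (Ls j) := ⟨by omega⟩
  exact (thermalStiffness_le_re_sectorGibbsAvg_oddMomentObs (L := Ls j) hβ hj15 hθ₀ (hst j) lam).trans hjb

end Hook

/-! ## §3 `T_c` closures -/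

namespace ThermalKTDictionaryAt

variable {tp U n : ℝ} {ρe : ℝ → ℝ} {Tc : ℝ}

/-- **ROUTE T-B′, kernel form: one certified thermal odd-moment word at `β` + `(π/4)q < 1/β` ⇒ `Tc ≤ 1/β`.** The
hypothesis is the torus-limit bound of `ObsThermalStiffnessSeqCeilingAtBeta_of_torusLimit_oddMoment_le`; the dictionary is
the monotonicity-free `ThermalKTDictionaryAt` (K2 stability + K1t identification). [cite: HazraVermaRanderia2019, eqs. (2)–(4)]
[cite: Lipparini2008, eq. (8.30)] -/
theorem le_inv_of_torusLimit_oddMoment_le (h : ThermalKTDictionaryAt tp U n ρe Tc) {β : ℝ} (hβ : 0 < β)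
    (hn0 : 0 ≤ n) (hn2 : n ≤ 2) (lam : ℝ) {q : ℚ}
    (hbound : ∀ (ω : InfVolFermionState 2) (Ls : ℕ → ℕ), Tendsto Ls atTop atTop →
      ω.IsTorusLimitOfMixture (sectorGibbsCount n) (fun L => sectorGibbsWeightTT' β 1 tp U n L)
        (fun L => sectorGibbsVectorTT' 1 tp U n L) Ls →
      oddMomentLimitFunctionalTT tp U lam ω ≤ ((q : ℚ) : ℝ))
    (hlt : Real.pi / 4 * ((q : ℚ) : ℝ) < 1 / β) : Tc ≤ 1 / β :=
  h.le_inv_of_leafAtBeta hβ (ObsThermalStiffnessSeqCeilingAtBeta_of_torusLimit_oddMoment_le hβ hn0 hn2 lam hbound) hlt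

/-- **Row form at `(8, ⅞, 0)`, `β·t = 4`** («`T_KT ≤ t/4`», monotonicity-free, below the f-sum class): if for one real
`λ` every torus limit `ω` of the canonical sector Gibbs states of `hubbardTorusTT' L 1 0 8` on `(rectN (7/8) L, S^z = 0)` at
`β = 4` has `½Re ω(k₀) + λ Re ω(d₁) − (λ²/2) Re ω(m₃′) ≤ q` with `q < 0.3183098` (`< 1/π`), then `Tc ≤ 1/4`. With the
certified kinetic word alone (`λ = 0`, `½Re ω(k₀) ≤ 0.3979249`, p489810) the margin to close is a certified odd-moment gain
`≥ 0.0797` per site. [cite: HazraVermaRanderia2019, eqs. (2)–(4)] [cite: Lipparini2008, eq. (8.30)] -/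
theorem le_quarter_of_torusLimit_oddMoment_le_four (h : ThermalKTDictionaryAt 0 8 (7 / 8) ρe Tc) (lam : ℝ) {q : ℚ}
    (hbound : ∀ (ω : InfVolFermionState 2) (Ls : ℕ → ℕ), Tendsto Ls atTop atTop →
      ω.IsTorusLimitOfMixture (sectorGibbsCount (7 / 8)) (fun L => sectorGibbsWeightTT' 4 1 0 8 (7 / 8) L)
        (fun L => sectorGibbsVectorTT' 1 0 8 (7 / 8) L) Ls →
      oddMomentLimitFunctionalTT 0 8 lam ω ≤ ((q : ℚ) : ℝ))
    (hq : ((q : ℚ) : ℝ) < 0.3183098) : Tc ≤ 1 / 4 :=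
  h.le_quarter_of_leafAtBeta_four
    (ObsThermalStiffnessSeqCeilingAtBeta_of_torusLimit_oddMoment_le (by norm_num) (by norm_num) (by norm_num) lam hbound) hq

end ThermalKTDictionaryAt

end Summit.Ventures.CertifiedManyBodySolver.Observables
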